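import Summits.QuantumFields.YangMills.Theorems.LangevinControlUVFemtoCurvatureTwoPointCLatticeStokes
import HarnessLib

/-!
# Slab decomposition of the four-torus Wilson weight — definitions
# (crux `CentreWallReflection.WallReflection` ⟨stmt-QuantumFields-23707⟩, line `birth`, stub `stub_instantiate`; planner ym-idea-4 g18)

The lattice objects behind the ring representation of the twisted/untwisted Wilson partition functions on the torus `(ℤ/(n+1))⁴` sliced
normal to a direction `μ`: translations, the GLUING of boundary slices into a configuration, plaquette costs (plain and with a central
insertion `z` on the stack `x_μ = x_ν = 0` of `(μ,ν)`-plaquettes), slab weights and slab actions `S_{[0,j]}`, the centre twist `twistMap`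
(left multiplication by `z` on the slice-`0` `ν`-links of the stack), edge sets, the slab kernels
`Ψ_j(X, A) = ∫ exp(−β S_{[0,j]}(glue_j(U; X, A))) dπ(U)`, the slab reflection, Polyakov holonomies of the slices, the Boltzmann weight and
the wall weights.  Pure definitions (theorems about them: the `CentreWallReflectionSlab*` modules).
HONEST FRAMING: bookkeeping objects for one crux of a draft route; nothing here proves the crux, the route's target, or the Yang–Mills mass gap.
References: [cite: OsterwalderSeiler1978, §2]; [cite: tHooft1979]; E. T. Tomboulis, L. G. Yaffe, CMP 100 (1985) 313.
-/

set_option autoImplicit false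

noncomputable section

open scoped BigOperators
open MeasureTheory Literature.MathematicalPhysics.QuantumFieldTheory

namespace Summit.QuantumFields.YangMills.Theorems.CentreWallReflection.Slab

variable {n : ℕ} {G : Type*} [Group G] {N : ℕ} (ρ : G →* Matrix (Fin N) (Fin N) ℂ) (μ : Fin 4)

/-- Translation by `j` lattice units in direction `μ`: `(translate μ j W)(x, λ) = W(x + j e_μ, λ)`. -/
def translate (j : ZMod (n + 1)) (W : GaugeConfig 4 (n + 1) G) : GaugeConfig 4 (n + 1) G :=
  fun e => W (e.1 + Pi.single μ j, e.2)

/-- The plaquette translation `p ↦ p + j e_μ` as a permutation. -/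
def plaqShift (j : ZMod (n + 1)) : Equiv.Perm (Plaquette 4 (n + 1)) where
  toFun p := (p.1 + Pi.single μ j, p.2)
  invFun p := (p.1 - Pi.single μ j, p.2)
  left_inv p := by simp
  right_inv p := by simp

/-- The edge translation `e ↦ e + j e_μ` as a permutation. -/
def edgeShift (j : ZMod (n + 1)) : Equiv.Perm (Edge 4 (n + 1)) where
  toFun e := (e.1 + Pi.single μ j, e.2)
  invFun e := (e.1 - Pi.single μ j, e.2)
  left_inv e := by simp
  right_inv e := by simp

/-- GLUING: slice `0` (spatial links with `x_μ = 0`) from `X`, slice `j` from the slice-`0` data of `A` (translated), every other link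
from `U`. -/
def glue (j : ℕ) (U X A : GaugeConfig 4 (n + 1) G) : GaugeConfig 4 (n + 1) G :=
  fun e => if e.2 ≠ μ ∧ e.1 μ = 0 then X e
    else if e.2 ≠ μ ∧ e.1 μ = (j : ZMod (n + 1)) then A (e.1 - Pi.single μ (j : ZMod (n + 1)), e.2)
    else U e

/-- The Wilson cost `N − Re tr ρ(U_p)` of a plaquette. -/
def plaqCost (W : GaugeConfig 4 (n + 1) G) (p : Plaquette 4 (n + 1)) : ℝ :=
  (N : ℝ) - (ρ (plaquetteHolonomy W p.1 p.2.1.1 p.2.1.2)).trace.re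

/-- The twisted cost: the plaquettes of plane `q` based at `x_{q₁} = x_{q₂} = 0` carry the central insertion `z` (the inline `Z`-device of
the route file). -/
def twistedCost (q : {p : Fin 4 × Fin 4 // p.1 < p.2}) (z : G) (W : GaugeConfig 4 (n + 1) G) (p : Plaquette 4 (n + 1)) : ℝ :=
  (N : ℝ) - (ρ ((if p.2 = q ∧ p.1 q.1.1 = 0 ∧ p.1 q.1.2 = 0 then z else 1) *
    plaquetteHolonomy W p.1 p.2.1.1 p.2.1.2)).trace.re

/-- A plaquette is temporal (w.r.t. `μ`) iff one of its two directions is `μ` (a `Bool`-valued test, to keep `if`s decidable). -/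
def isTemporal (p : Plaquette 4 (n + 1)) : Bool := decide (p.2.1.1 = μ) || decide (p.2.1.2 = μ)

/-- Weight of a plaquette in the slab `[0, j]`: temporal plaquettes of layers `0 … j−1` and spatial plaquettes of the interior slices
`1 … j−1` count fully, spatial plaquettes of the boundary slices `0` and `j` count half. -/
def slabWeight (j : ℕ) (p : Plaquette 4 (n + 1)) : ℝ :=
  if isTemporal μ p then (if (p.1 μ).val < j then 1 else 0)
  else (if 0 < (p.1 μ).val ∧ (p.1 μ).val < j then 1 else if (p.1 μ).val = 0 ∨ (p.1 μ).val = j then 1 / 2 else 0)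

/-- The slab action `S_{[0,j]}(W) = Σ_p w_j(p) (N − Re tr ρ(W_p))`. -/
def slabAction (j : ℕ) (W : GaugeConfig 4 (n + 1) G) : ℝ :=
  ∑ p : Plaquette 4 (n + 1), slabWeight μ j p * plaqCost ρ W p

/-- The complementary slab action `Σ_p (1 − w_j(p)) (N − Re tr ρ(W_p))`. -/
def coSlabAction (j : ℕ) (W : GaugeConfig 4 (n + 1) G) : ℝ :=
  ∑ p : Plaquette 4 (n + 1), (1 - slabWeight μ j p) * plaqCost ρ W p

/-- The central-valued configuration: `z` on the `ν`-links of slice `0` issuing from sites with `x_ν = 0`, `1` elsewhere. -/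
def stackConfig (ν : Fin 4) (z : G) : GaugeConfig 4 (n + 1) G :=
  fun e => if e.2 = ν ∧ e.1 μ = 0 ∧ e.1 ν = 0 then z else 1

/-- The centre twist: left multiplication by `z` on the `ν`-links of slice `0` issuing from sites with `x_ν = 0`. -/
def twistMap (ν : Fin 4) (z : G) (W : GaugeConfig 4 (n + 1) G) : GaugeConfig 4 (n + 1) G := stackConfig μ ν z * W

/-- The spatial links of slice `t`. -/
def sliceEdges (t : ZMod (n + 1)) : Finset (Edge 4 (n + 1)) := Finset.univ.filter fun e => e.2 ≠ μ ∧ e.1 μ = t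

/-- The links read by the slab action `S_{[0,j]}`: temporal links of layers `< j`, spatial links of slices `≤ j`. -/
def slabEdges (j : ℕ) : Finset (Edge 4 (n + 1)) :=
  Finset.univ.filter fun e => if e.2 = μ then (e.1 μ).val < j else (e.1 μ).val ≤ j

/-- The interior links of the slab: temporal links of layers `< j`, spatial links of slices `1 … j−1`. -/
def slabInterior (j : ℕ) : Finset (Edge 4 (n + 1)) :=
  Finset.univ.filter fun e => if e.2 = μ then (e.1 μ).val < j else (0 < (e.1 μ).val ∧ (e.1 μ).val < j)

/-- The links read by the complementary slab action: temporal links of layers `≥ j`, spatial links of slices `0` and `≥ j`. -/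
def coSlabEdges (j : ℕ) : Finset (Edge 4 (n + 1)) :=
  Finset.univ.filter fun e => if e.2 = μ then j ≤ (e.1 μ).val else (j ≤ (e.1 μ).val ∨ (e.1 μ).val = 0)

/-- Site reflection `x_μ ↦ j − x_μ`. -/
def siteReflect (j : ℕ) (x : Site 4 (n + 1)) : Site 4 (n + 1) := Function.update x μ ((j : ZMod (n + 1)) - x μ)

/-- The edge involution underlying the slab reflection (temporal edges are reversed). -/
def edgeReflect (j : ℕ) (e : Edge 4 (n + 1)) : Edge 4 (n + 1) :=
  if e.2 = μ then (siteReflect μ j (e.1.shift μ), μ) else (siteReflect μ j e.1, e.2)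

/-- The slab reflection on configurations: spatial links are carried along `x ↦ θx`, temporal links are reversed and inverted. -/
def slabReflect (j : ℕ) (W : GaugeConfig 4 (n + 1) G) : GaugeConfig 4 (n + 1) G :=
  fun e => if e.2 = μ then (W (siteReflect μ j (e.1.shift μ), μ))⁻¹ else W (siteReflect μ j e.1, e.2)

/-- The plaquette involution underlying the reflection invariance of the slab action. -/
def plaqReflect (j : ℕ) (p : Plaquette 4 (n + 1)) : Plaquette 4 (n + 1) :=
  (if isTemporal μ p then siteReflect μ j (p.1.shift μ) else siteReflect μ j p.1, p.2)

/-- The base site `t e_μ` of slice `t`. -/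
def baseSite (t : ℕ) : Site 4 (n + 1) := fun i => if i = μ then ((t : ℕ) : ZMod (n + 1)) else 0

/-- The `ν`-Polyakov holonomy of slice `t` (based at `t e_μ`, winding once in direction `ν`). -/
def polyakov (ν : Fin 4) (t : ℕ) (W : GaugeConfig 4 (n + 1) G) : G := lineHolonomy W ν (n + 1) (baseSite μ t)

section Kernels

variable [TopologicalSpace G] [IsTopologicalGroup G] [CompactSpace G] [MeasurableSpace G] [BorelSpace G]

/-- **The slab kernel** `Ψ_j(X, A) = ∫ exp(−β S_{[0,j]}(glue_j(U; X, A))) dπ(U)`: the Boltzmann weight of the slab `[0, j]` with bottom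
slice read from `X` (slice `0`) and top slice read from `A` (slice `0`, translated to `j`), the interior integrated out against product Haar
measure. -/
def slabKernel (β : ℝ) (j : ℕ) (X A : GaugeConfig 4 (n + 1) G) : ℝ :=
  ∫ U, Real.exp (-(β * slabAction ρ μ j (glue μ j U X A))) ∂(Measure.pi fun _ : Edge 4 (n + 1) => haarProbability G)

/-- The untwisted Boltzmann weight `e^{−β Σ_p c_p}`. -/
def boltz (β : ℝ) (W : GaugeConfig 4 (n + 1) G) : ℝ := Real.exp (-(β * ∑ p : Plaquette 4 (n + 1), plaqCost ρ W p))

/-- The wall weight of slice `t`: `N_t = ∫ 𝟙_W(P_t) e^{−βS} dπ`. -/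
def wallWeight (ν : Fin 4) (β : ℝ) (Wset : Set G) (t : ℕ) : ℝ :=
  ∫ W, Wset.indicator (fun _ => (1 : ℝ)) (polyakov μ ν t W) * boltz ρ β W ∂(Measure.pi fun _ : Edge 4 (n + 1) => haarProbability G)

end Kernels

end Summit.QuantumFields.YangMills.Theorems.CentreWallReflection.Slab

end
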